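import Mathlib
import Summits.ValiantsHypothesis.ValiantsHypothesis.Theses.ValuativeGCT
import Summits.ValiantsHypothesis.ValiantsHypothesis.Theorems.CutBites.Negative.EvenDegreeOrderParity

/-!
# `CutBites` — negative lemma: NO SECOND STEP AT THE FIRST RUNG; THE WITNESS SHAPE IS NECESSARY

Crux `stmt-ValiantsHypothesis-12626` (`Theses.ValuativeGCT.CutBites`, route ValuativeGCT).  Standing
disprover (cdisprove gen 3), `Cruxes/CutBites/Disproof.lean` §G, consequences of
`EvenDegreeOrderParity` (`T 2 = T 1` at `δ = 2` for every `m`) over the crux's literal `let`-blocks: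

* `cutBites_not_lt_second_step` / `cutBites_no_strict_second_step` — the strengthening "at `δ = 2`
  the filtration also drops at the second step, `finrank (T 2) < finrank (T 1)`" is FALSE (witness
  `m = 3`; in fact every `m` and every `λ`).
* `cutBites_finrank_lt_of_witness` — the cut criterion (Disproof §B): one element of `T 0` with one
  non-zero value at a point all of whose rows are skew gives `finrank (T t) < finrank (T 0)`, `t ≥ 1`.
* `cutBites_firstRung_lt_iff_witness` — at `δ = 2`, `finrank (T 2) < finrank (T 0)` holds IFF some
  element of `T 0` has a non-zero value at such a point: the order-zero witness shape (what every
  registered line proves) is not only sufficient but NECESSARY at the first rung.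
[folklore]
-/

namespace Summit.ValiantsHypothesis.ValiantsHypothesis.Theorems.CutBites.Negative

open Literature.NumberTheory.DiophantineGeometry Literature.Computability.AlgebraicComplexity
open MvPolynomial
open scoped BigOperators Matrix

noncomputable section

/-- Hence at `δ = 2` no weight has `finrank (T 2) < finrank (T 1)`. [folklore] -/
theorem cutBites_not_lt_second_step (m : ℕ) (lam : Nat.Partition (m * 2)) :
    (let U : Submodule ℂ (MatIdx m → ℂ) :=
        Submodule.span ℂ {u : MatIdx m → ℂ | ∀ a b : Fin m, u (toLex (a, b)) = -u (toLex (b, a))};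
      let χ : Weight (MatIdx m) := (Weight.dualOfPartition (m * m) lam).toMatIdx;
      let T : ℕ → Submodule ℂ (MvPolynomial (MatIdx m × MatIdx m) ℂ) := fun t =>
        MvPolynomial.homogeneousSubmodule (MatIdx m × MatIdx m) ℂ (m * 2)
        ⊓ ((MvPolynomial.vanishingIdeal ℂ {p : MatIdx m × MatIdx m → ℂ |
              ∀ j : MatIdx m, (fun i => p (j, i)) ∈ U}) ^ (t)).restrictScalars ℂ
        ⊓ (⨅ (M : Matrix (MatIdx m) (MatIdx m) ℂ)
            (_ : linSubst (MatIdx m) ℂ M (detFormLex ℂ m) = detFormLex ℂ m),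
            LinearMap.ker ((MvPolynomial.aeval (R := ℂ) fun p : MatIdx m × MatIdx m =>
              ∑ l : MatIdx m, M l p.2 • MvPolynomial.X (p.1, l)).toLinearMap
              - LinearMap.id (R := ℂ) (M := MvPolynomial (MatIdx m × MatIdx m) ℂ)))
        ⊓ (⨅ (g : Matrix.GeneralLinearGroup (MatIdx m) ℂ) (_ : IsUpperTriangular g),
            LinearMap.ker ((MvPolynomial.aeval (R := ℂ) fun p : MatIdx m × MatIdx m =>
              ∑ l : MatIdx m, ((g⁻¹ : Matrix.GeneralLinearGroup (MatIdx m) ℂ) :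
                Matrix (MatIdx m) (MatIdx m) ℂ) p.1 l • MvPolynomial.X (l, p.2)).toLinearMap
              - weightChar χ g • LinearMap.id (R := ℂ) (M := MvPolynomial (MatIdx m × MatIdx m) ℂ)));
      ¬ (Module.finrank ℂ ↥(T 2) < Module.finrank ℂ ↥(T 1))) := by
  intro U χ T
  have key : T 2 = T 1 := cutBites_trunc_firstRung_two_eq_one m lam
  rw [key]
  exact lt_irrefl _

/-- **Refuted strengthening (second step at the first rung).**  "For every odd `m ≥ 3` some
`λ ⊢ 2m` has `finrank (T 2) < finrank (T 1)`" is FALSE (witness `m = 3`; every `m` by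
`cutBites_not_lt_second_step`). [folklore] -/
theorem cutBites_no_strict_second_step :
    ¬ (∀ m : ℕ, Odd m → 3 ≤ m → ∃ lam : Nat.Partition (m * 2), lam.parts.card ≤ m * m ∧
      (let U : Submodule ℂ (MatIdx m → ℂ) :=
        Submodule.span ℂ {u : MatIdx m → ℂ | ∀ a b : Fin m, u (toLex (a, b)) = -u (toLex (b, a))};
      let χ : Weight (MatIdx m) := (Weight.dualOfPartition (m * m) lam).toMatIdx;
      let T : ℕ → Submodule ℂ (MvPolynomial (MatIdx m × MatIdx m) ℂ) := fun t =>
        MvPolynomial.homogeneousSubmodule (MatIdx m × MatIdx m) ℂ (m * 2)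
        ⊓ ((MvPolynomial.vanishingIdeal ℂ {p : MatIdx m × MatIdx m → ℂ |
              ∀ j : MatIdx m, (fun i => p (j, i)) ∈ U}) ^ (t)).restrictScalars ℂ
        ⊓ (⨅ (M : Matrix (MatIdx m) (MatIdx m) ℂ)
            (_ : linSubst (MatIdx m) ℂ M (detFormLex ℂ m) = detFormLex ℂ m),
            LinearMap.ker ((MvPolynomial.aeval (R := ℂ) fun p : MatIdx m × MatIdx m =>
              ∑ l : MatIdx m, M l p.2 • MvPolynomial.X (p.1, l)).toLinearMap
              - LinearMap.id (R := ℂ) (M := MvPolynomial (MatIdx m × MatIdx m) ℂ)))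
        ⊓ (⨅ (g : Matrix.GeneralLinearGroup (MatIdx m) ℂ) (_ : IsUpperTriangular g),
            LinearMap.ker ((MvPolynomial.aeval (R := ℂ) fun p : MatIdx m × MatIdx m =>
              ∑ l : MatIdx m, ((g⁻¹ : Matrix.GeneralLinearGroup (MatIdx m) ℂ) :
                Matrix (MatIdx m) (MatIdx m) ℂ) p.1 l • MvPolynomial.X (l, p.2)).toLinearMap
              - weightChar χ g • LinearMap.id (R := ℂ) (M := MvPolynomial (MatIdx m × MatIdx m) ℂ)));
      Module.finrank ℂ ↥(T 2) < Module.finrank ℂ ↥(T 1))) := by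
  intro h
  obtain ⟨lam, -, hlt⟩ := h 3 (by decide) le_rfl
  exact cutBites_not_lt_second_step 3 lam hlt

/-- **Cut criterion** (Disproof §B over the `let`-blocks): an element of `T 0` with one non-zero
value at a point all of whose rows are skew forces `finrank (T t) < finrank (T 0)` for every
`t ≥ 1`. [folklore] -/
theorem cutBites_finrank_lt_of_witness (m δ : ℕ) (lam : Nat.Partition (m * δ)) :
    (let U : Submodule ℂ (MatIdx m → ℂ) :=
        Submodule.span ℂ {u : MatIdx m → ℂ | ∀ a b : Fin m, u (toLex (a, b)) = -u (toLex (b, a))};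
      let χ : Weight (MatIdx m) := (Weight.dualOfPartition (m * m) lam).toMatIdx;
      let T : ℕ → Submodule ℂ (MvPolynomial (MatIdx m × MatIdx m) ℂ) := fun t =>
        MvPolynomial.homogeneousSubmodule (MatIdx m × MatIdx m) ℂ (m * δ)
        ⊓ ((MvPolynomial.vanishingIdeal ℂ {p : MatIdx m × MatIdx m → ℂ |
              ∀ j : MatIdx m, (fun i => p (j, i)) ∈ U}) ^ (t)).restrictScalars ℂ
        ⊓ (⨅ (M : Matrix (MatIdx m) (MatIdx m) ℂ)
            (_ : linSubst (MatIdx m) ℂ M (detFormLex ℂ m) = detFormLex ℂ m),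
            LinearMap.ker ((MvPolynomial.aeval (R := ℂ) fun p : MatIdx m × MatIdx m =>
              ∑ l : MatIdx m, M l p.2 • MvPolynomial.X (p.1, l)).toLinearMap
              - LinearMap.id (R := ℂ) (M := MvPolynomial (MatIdx m × MatIdx m) ℂ)))
        ⊓ (⨅ (g : Matrix.GeneralLinearGroup (MatIdx m) ℂ) (_ : IsUpperTriangular g),
            LinearMap.ker ((MvPolynomial.aeval (R := ℂ) fun p : MatIdx m × MatIdx m =>
              ∑ l : MatIdx m, ((g⁻¹ : Matrix.GeneralLinearGroup (MatIdx m) ℂ) :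
                Matrix (MatIdx m) (MatIdx m) ℂ) p.1 l • MvPolynomial.X (l, p.2)).toLinearMap
              - weightChar χ g • LinearMap.id (R := ℂ) (M := MvPolynomial (MatIdx m × MatIdx m) ℂ)));
      ∀ t : ℕ, 0 < t → ∀ G ∈ T 0, ∀ p : MatIdx m × MatIdx m → ℂ,
        (∀ j : MatIdx m, (fun i => p (j, i)) ∈ U) → MvPolynomial.eval p G ≠ 0 →
        Module.finrank ℂ ↥(T t) < Module.finrank ℂ ↥(T 0)) := by
  intro U χ T t ht G hG p hp hGp
  have hle0 : ∀ s, T s ≤ MvPolynomial.homogeneousSubmodule (MatIdx m × MatIdx m) ℂ (m * δ) :=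
    fun s => inf_le_left.trans (inf_le_left.trans inf_le_left)
  have hfin : Module.Finite ℂ ↥(MvPolynomial.homogeneousSubmodule (MatIdx m × MatIdx m) ℂ (m * δ)) :=
    Module.Finite.iff_fg.mpr (MvPolynomial.homogeneousSubmodule_fg _ ℂ (m * δ))
  haveI : FiniteDimensional ℂ ↥(T 0) := Submodule.finiteDimensional_of_le (hle0 0)
  have hle : T t ≤ T 0 :=
    inf_le_inf_right _ (inf_le_inf_right _ (inf_le_inf_left _
      (Submodule.restrictScalars_mono ℂ (Ideal.pow_le_pow_right (Nat.zero_le t)))))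
  refine Submodule.finrank_lt_finrank_of_lt (lt_of_le_of_ne hle fun h => hGp ?_)
  have hG' : G ∈ T t := by rw [h]; exact hG
  have h1 : G ∈ ((MvPolynomial.vanishingIdeal ℂ {p : MatIdx m × MatIdx m → ℂ |
      ∀ j : MatIdx m, (fun i => p (j, i)) ∈ U}) ^ t).restrictScalars ℂ :=
    (Submodule.mem_inf.mp (Submodule.mem_inf.mp (Submodule.mem_inf.mp hG').1).1).2
  have h2 : G ∈ (MvPolynomial.vanishingIdeal ℂ {p : MatIdx m × MatIdx m → ℂ |
      ∀ j : MatIdx m, (fun i => p (j, i)) ∈ U}).restrictScalars ℂ :=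
    Submodule.restrictScalars_mono ℂ ((Ideal.pow_le_pow_right ht).trans_eq (pow_one _)) h1
  rw [Submodule.restrictScalars_mem, mem_vanishingIdeal_iff] at h2
  simpa [MvPolynomial.coe_aeval_eq_eval] using h2 p hp

/-- **The witness shape is necessary at the first rung.**  For every `m` and every `λ ⊢ 2m`:
`finrank (T 2) < finrank (T 0)` IFF some element of `T 0` has a non-zero value at a point all of
whose rows are skew (⇐: the cut criterion; ⇒: `T 2 = T 1 = T 0 ∩ P_Λ`). [folklore] -/
theorem cutBites_firstRung_lt_iff_witness (m : ℕ) (lam : Nat.Partition (m * 2)) :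
    (let U : Submodule ℂ (MatIdx m → ℂ) :=
        Submodule.span ℂ {u : MatIdx m → ℂ | ∀ a b : Fin m, u (toLex (a, b)) = -u (toLex (b, a))};
      let χ : Weight (MatIdx m) := (Weight.dualOfPartition (m * m) lam).toMatIdx;
      let T : ℕ → Submodule ℂ (MvPolynomial (MatIdx m × MatIdx m) ℂ) := fun t =>
        MvPolynomial.homogeneousSubmodule (MatIdx m × MatIdx m) ℂ (m * 2)
        ⊓ ((MvPolynomial.vanishingIdeal ℂ {p : MatIdx m × MatIdx m → ℂ |
              ∀ j : MatIdx m, (fun i => p (j, i)) ∈ U}) ^ (t)).restrictScalars ℂ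
        ⊓ (⨅ (M : Matrix (MatIdx m) (MatIdx m) ℂ)
            (_ : linSubst (MatIdx m) ℂ M (detFormLex ℂ m) = detFormLex ℂ m),
            LinearMap.ker ((MvPolynomial.aeval (R := ℂ) fun p : MatIdx m × MatIdx m =>
              ∑ l : MatIdx m, M l p.2 • MvPolynomial.X (p.1, l)).toLinearMap
              - LinearMap.id (R := ℂ) (M := MvPolynomial (MatIdx m × MatIdx m) ℂ)))
        ⊓ (⨅ (g : Matrix.GeneralLinearGroup (MatIdx m) ℂ) (_ : IsUpperTriangular g),
            LinearMap.ker ((MvPolynomial.aeval (R := ℂ) fun p : MatIdx m × MatIdx m =>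
              ∑ l : MatIdx m, ((g⁻¹ : Matrix.GeneralLinearGroup (MatIdx m) ℂ) :
                Matrix (MatIdx m) (MatIdx m) ℂ) p.1 l • MvPolynomial.X (l, p.2)).toLinearMap
              - weightChar χ g • LinearMap.id (R := ℂ) (M := MvPolynomial (MatIdx m × MatIdx m) ℂ)));
      Module.finrank ℂ ↥(T 2) < Module.finrank ℂ ↥(T 0) ↔
        ∃ G ∈ T 0, ∃ p : MatIdx m × MatIdx m → ℂ,
          (∀ j : MatIdx m, (fun i => p (j, i)) ∈ U) ∧ MvPolynomial.eval p G ≠ 0) := by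
  intro U χ T
  have h21 : T 2 = T 1 := cutBites_trunc_firstRung_two_eq_one m lam
  have hcrit := cutBites_finrank_lt_of_witness m 2 lam
  constructor
  · intro hlt
    by_contra hno
    simp only [not_exists, not_and, not_not, ne_eq] at hno
    have hle0 : ∀ s, T s ≤ MvPolynomial.homogeneousSubmodule (MatIdx m × MatIdx m) ℂ (m * 2) :=
      fun s => inf_le_left.trans (inf_le_left.trans inf_le_left)
    have hfin : Module.Finite ℂ ↥(MvPolynomial.homogeneousSubmodule (MatIdx m × MatIdx m) ℂ (m * 2)) :=
      Module.Finite.iff_fg.mpr (MvPolynomial.homogeneousSubmodule_fg _ ℂ (m * 2))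
    haveI : FiniteDimensional ℂ ↥(T 2) := Submodule.finiteDimensional_of_le (hle0 2)
    have hle : T 0 ≤ T 2 := by
      intro G hG
      rw [h21]
      have hGh := (Submodule.mem_inf.mp (Submodule.mem_inf.mp (Submodule.mem_inf.mp hG).1).1).1
      have hGs := (Submodule.mem_inf.mp (Submodule.mem_inf.mp hG).1).2
      have hGw := (Submodule.mem_inf.mp hG).2
      refine Submodule.mem_inf.mpr ⟨Submodule.mem_inf.mpr ⟨Submodule.mem_inf.mpr ⟨hGh, ?_⟩, hGs⟩, hGw⟩
      rw [pow_one, Submodule.restrictScalars_mem, mem_vanishingIdeal_iff]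
      intro p hp
      simpa [MvPolynomial.coe_aeval_eq_eval] using hno G hG p hp
    exact absurd (Submodule.finrank_mono hle) (not_le.mpr hlt)
  · rintro ⟨G, hG, p, hp, hGp⟩
    exact hcrit 2 two_pos G hG p hp hGp

end

end Summit.ValiantsHypothesis.ValiantsHypothesis.Theorems.CutBites.Negative
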